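import Summits.CriticalPhenomena.PercolationContinuityZ3.Theorems.Transplant.HeisenbergKGroup
import Summits.CriticalPhenomena.PercolationContinuityZ3.Theorems.Transplant.SkeletonDropNode
import HarnessLib

/-!
# The diagonal `D₄` of `H_{2k+1}(ℤ)` and the planar skeleton over one generator pair `(a_j, b_j)` (input Φ1)

builds on p205010 (kernel theorem, internal audit signed; external expert review pending) — nothing in this file uses p205010.
Lane `prim-bschramm`, seat `prim-bschramm-p4` (gen 4; class map, memo `P4-GENERAL.md` §12), helper file
(`--supports stmt-CriticalPhenomena-4575`).  Second file of the `HeisenbergK*` series; pattern of `HeisenbergZSymmetry.lean` (p218684).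

A signed permutation of ONE pair `(A_j, B_j)` is not an automorphism of `H_{2k+1}` (it would invert `C = [A_j,B_j] = [A_i,B_i]`), but the
DIAGONAL ones are: `hkSwap (a,b,c) = (b, a, ⟨a,b⟩ − c)` (all `A_i ↔ B_i` at once, `C ↦ C⁻¹`) and `hkFlip (a,b,c) = (−a, b, −c)` (all
`A_i ↦ A_i⁻¹`), both involutive, multiplicative and `S`-preserving, hence Cayley-graph automorphisms fixing `1` (`hkSwapIso`, `hkFlipIso`);
they generate a `D₄` acting on the skeleton `(a_j, b_j)` as the full point group `HOct 2` (`hkPointIso`, `hkAb_hkPointIso`).  With the left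
translations as frames: **`hkSkeleton j : PlanarSkeleton (hkGraph k)`** — input Φ1 of the lane's planar node for `H_{2k+1}(ℤ)` over the pair `j`;
its cylinders are `{|a_j|, |b_j| ≤ ℓ}` (`mem_hkSkeleton_cyl`), THICK: they contain `⟨A_i, B_i (i ≠ j), C⟩ ≅ H_{2k−1}(ℤ)`.
[cite: KozmaNitzan2024, §4 p. 16 (Lemma 8: coordinate permutations and reflections)] [cite: BenjaminiSchramm1996, §2]
[cite: ContrerasMartineauTassion2024, §1.1]
-/

noncomputable section

namespace Summit.CriticalPhenomena.PercolationContinuityZ3.Theorems.Transplant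

open MeasureTheory Literature.Probability.Percolation Literature.Probability.LatticeModels
open Literature.Probability.Percolation.GM

variable {k : ℕ}

/-! ## §1 Involutive multiplicative maps preserving `S` are graph automorphisms -/

/-- An involutive multiplicative self-map of `H_{2k+1}` mapping `S` into `S` is an automorphism of the Cayley graph. [folklore] -/
def hkIsoOfInvolutive (σ : HK k → HK k) (hσσ : ∀ x, σ (σ x) = x) (hmul : ∀ x y, σ (hkMul x y) = hkMul (σ x) (σ y))
    (hgen : ∀ s ∈ hkGens k, σ s ∈ hkGens k) : hkGraph k ≃g hkGraph k where
  toEquiv := ⟨σ, σ, hσσ, hσσ⟩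
  map_rel_iff' := by
    intro x y
    simp only [Equiv.coe_fn_mk, hkGraph_adj_iff]
    constructor
    · rintro ⟨s, hs, h⟩
      refine ⟨σ s, hgen s hs, ?_⟩
      have := congrArg σ h
      rwa [hσσ, hmul, hσσ] at this
    · rintro ⟨s, hs, rfl⟩
      exact ⟨σ s, hgen s hs, hmul x s⟩

/-! ## §2 The diagonal swap and flip -/

/-- The pairing is symmetric. [folklore] -/
theorem hkDot_comm (a b : Fin k → ℤ) : hkDot a b = hkDot b a := by
  simp [hkDot, mul_comm]

/-- The diagonal swap `(a,b,c) ↦ (b, a, ⟨a,b⟩ − c)` (all `A_i ↔ B_i`, `C ↦ C⁻¹`). [cite: KozmaNitzan2024, §4 p. 16 (Lemma 8)] -/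
def hkSwap (x : HK k) : HK k := (x.2.1, x.1, hkDot x.1 x.2.1 - x.2.2)

/-- The diagonal flip `(a,b,c) ↦ (−a, b, −c)` (all `A_i ↦ A_i⁻¹`). [cite: KozmaNitzan2024, §4 p. 16 (Lemma 8)] -/
def hkFlip (x : HK k) : HK k := (-x.1, x.2.1, -x.2.2)

/-- `hkSwap` is an involution. [folklore] -/
@[simp] theorem hkSwap_hkSwap (x : HK k) : hkSwap (hkSwap x) = x := by
  refine Prod.ext rfl (Prod.ext rfl ?_)
  simp only [hkSwap]; rw [hkDot_comm]; ring

/-- `hkFlip` is an involution. [folklore] -/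
@[simp] theorem hkFlip_hkFlip (x : HK k) : hkFlip (hkFlip x) = x := by
  refine Prod.ext ?_ (Prod.ext rfl ?_) <;> simp [hkFlip]

/-- `hkSwap` is multiplicative. [folklore] -/
theorem hkSwap_hkMul (x y : HK k) : hkSwap (hkMul x y) = hkMul (hkSwap x) (hkSwap y) := by
  refine Prod.ext rfl (Prod.ext rfl ?_)
  simp only [hkSwap, hkMul_c, hkMul_a, hkMul_b, hkDot_add_left, hkDot_add_right]
  rw [hkDot_comm x.2.1 y.1]; ring

/-- `hkFlip` is multiplicative. [folklore] -/
theorem hkFlip_hkMul (x y : HK k) : hkFlip (hkMul x y) = hkMul (hkFlip x) (hkFlip y) := by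
  refine Prod.ext ?_ (Prod.ext rfl ?_)
  · simp [hkFlip]; abel
  · simp only [hkFlip, hkMul_c, hkDot_neg_left]; ring

/-- `hkSwap` maps `S` to `S` (`A_i ↔ B_i`, `A_i⁻¹ ↔ B_i⁻¹`). [folklore] -/
theorem hkSwap_gen (s : HK k) (hs : s ∈ hkGens k) : hkSwap s ∈ hkGens k := by
  obtain ⟨i, rfl | rfl | rfl | rfl⟩ := (mem_hkGens_iff s).1 hs
  · have : hkSwap (hkA i : HK k) = hkB i := Prod.ext rfl (Prod.ext rfl (by simp [hkSwap, hkA, hkB]))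
    rw [this]; exact hkB_mem i
  · have : hkSwap (hkB i : HK k) = hkA i := Prod.ext rfl (Prod.ext rfl (by simp [hkSwap, hkA, hkB]))
    rw [this]; exact hkA_mem i
  · have : hkSwap (hkAinv i : HK k) = hkBinv i := Prod.ext rfl (Prod.ext rfl (by simp [hkSwap, hkAinv, hkBinv]))
    rw [this]; exact hkBinv_mem i
  · have : hkSwap (hkBinv i : HK k) = hkAinv i := Prod.ext rfl (Prod.ext rfl (by simp [hkSwap, hkAinv, hkBinv]))
    rw [this]; exact hkAinv_mem i

/-- `hkFlip` maps `S` to `S` (`A_i ↔ A_i⁻¹`, `B_i`, `B_i⁻¹` fixed). [folklore] -/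
theorem hkFlip_gen (s : HK k) (hs : s ∈ hkGens k) : hkFlip s ∈ hkGens k := by
  obtain ⟨i, rfl | rfl | rfl | rfl⟩ := (mem_hkGens_iff s).1 hs
  · have : hkFlip (hkA i : HK k) = hkAinv i := Prod.ext rfl (Prod.ext rfl (by simp [hkFlip, hkA, hkAinv]))
    rw [this]; exact hkAinv_mem i
  · have : hkFlip (hkB i : HK k) = hkB i := Prod.ext (by simp [hkFlip, hkB]) (Prod.ext rfl (by simp [hkFlip, hkB]))
    rw [this]; exact hkB_mem i
  · have : hkFlip (hkAinv i : HK k) = hkA i := Prod.ext (by simp [hkFlip, hkA, hkAinv]) (Prod.ext rfl (by simp [hkFlip, hkA, hkAinv]))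
    rw [this]; exact hkA_mem i
  · have : hkFlip (hkBinv i : HK k) = hkBinv i := Prod.ext (by simp [hkFlip, hkBinv]) (Prod.ext rfl (by simp [hkFlip, hkBinv]))
    rw [this]; exact hkBinv_mem i

/-- **The diagonal swap as a Cayley-graph automorphism.** [cite: KozmaNitzan2024, §4 p. 16 (Lemma 8)] -/
def hkSwapIso : hkGraph k ≃g hkGraph k := hkIsoOfInvolutive hkSwap hkSwap_hkSwap hkSwap_hkMul hkSwap_gen
/-- **The diagonal flip as a Cayley-graph automorphism.** [cite: KozmaNitzan2024, §4 p. 16 (Lemma 8)] -/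
def hkFlipIso : hkGraph k ≃g hkGraph k := hkIsoOfInvolutive hkFlip hkFlip_hkFlip hkFlip_hkMul hkFlip_gen

/-- `hkSwapIso` acts by `hkSwap`. [folklore] -/
@[simp] theorem hkSwapIso_apply (x : HK k) : hkSwapIso x = hkSwap x := rfl
/-- `hkFlipIso` acts by `hkFlip`. [folklore] -/
@[simp] theorem hkFlipIso_apply (x : HK k) : hkFlipIso x = hkFlip x := rfl
/-- `hkSwap 1 = 1`. [folklore] -/
@[simp] theorem hkSwap_zero : hkSwap (0 : HK k) = 0 := Prod.ext rfl (Prod.ext rfl (by simp [hkSwap]))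
/-- `hkFlip 1 = 1`. [folklore] -/
@[simp] theorem hkFlip_zero : hkFlip (0 : HK k) = 0 := by refine Prod.ext ?_ (Prod.ext rfl ?_) <;> simp [hkFlip]
/-- The identity iso acts trivially. [folklore] -/
@[simp] theorem hk_iso_refl_apply (w : HK k) : (SimpleGraph.Iso.refl (G := hkGraph k)) w = w := rfl

/-! ## §3 The lifted point group `HOct 2` on the pair `j` -/

/-- The conjugate flip `swap ∘ flip ∘ swap`: `(a,b,c) ↦ (a, −b, −c)` (all `B_i ↦ B_i⁻¹`). [folklore] -/
def hkFlip1Iso : hkGraph k ≃g hkGraph k := hkSwapIso.trans (hkFlipIso.trans hkSwapIso)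

/-- `hkFlip1Iso` in coordinates. [folklore] -/
theorem hkFlip1Iso_apply (x : HK k) : hkFlip1Iso x = (x.1, -x.2.1, -x.2.2) := by
  show hkSwap (hkFlip (hkSwap x)) = _
  refine Prod.ext rfl (Prod.ext rfl ?_)
  simp only [hkSwap, hkFlip, hkDot_neg_left]; rw [hkDot_comm]; ring

/-- The sign part: flip the `a`'s if `ε 0 = −1`, the `b`'s if `ε 1 = −1`. [folklore] -/
def hkSignIso (ε : Fin 2 → ℤˣ) : hkGraph k ≃g hkGraph k :=
  (if ε 0 = 1 then SimpleGraph.Iso.refl (G := hkGraph k) else hkFlipIso).trans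
    (if ε 1 = 1 then SimpleGraph.Iso.refl (G := hkGraph k) else hkFlip1Iso)

/-- **The lifted point group**: for `g = (π, ε)`, first the diagonal swap (if `π ≠ 1`), then the sign flips.
[cite: KozmaNitzan2024, §4 p. 16 (Lemma 8)] -/
def hkPointIso (g : HOct 2) : hkGraph k ≃g hkGraph k :=
  (if g.1 = 1 then SimpleGraph.Iso.refl (G := hkGraph k) else hkSwapIso).trans (hkSignIso g.2)

/-- The sign isomorphisms fix `1`. [folklore] -/
theorem hkSignIso_zero (ε : Fin 2 → ℤˣ) : hkSignIso ε (0 : HK k) = 0 := by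
  unfold hkSignIso
  split_ifs <;> simp [hkFlip1Iso_apply]

/-- The point isomorphisms fix `1`. [folklore] -/
@[simp] theorem hkPointIso_zero (g : HOct 2) : hkPointIso g (0 : HK k) = 0 := by
  unfold hkPointIso
  split_ifs <;> simp [hkSignIso_zero]

/-- Action of the sign isomorphisms on the skeleton: coordinatewise signs. [folklore] -/
theorem hkAb_hkSignIso (j : Fin k) (ε : Fin 2 → ℤˣ) (w : HK k) (i : Fin 2) :
    hkAb j (hkSignIso ε w) i = (ε i : ℤ) * hkAb j w i := by
  unfold hkSignIso
  rcases Int.units_eq_one_or (ε 0) with h0 | h0 <;> rcases Int.units_eq_one_or (ε 1) with h1 | h1 <;>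
    fin_cases i <;> simp [h0, h1, hkAb, hkFlip, hkFlip1Iso_apply]

/-- **Equivariance of the skeleton map**: `hkAb j ∘ hkPointIso g = sp g ∘ hkAb j`. [cite: KozmaNitzan2024, §4 p. 16 (Lemma 8)] -/
theorem hkAb_hkPointIso (j : Fin k) (g : HOct 2) (w : HK k) : hkAb j (hkPointIso g w) = sp g (hkAb j w) := by
  obtain ⟨π, ε⟩ := g
  ext i
  rw [Site.signedPerm_apply]
  have hperm : ∀ τ : Equiv.Perm (Fin 2), τ = 1 ∨ τ = Equiv.swap 0 1 := by decide
  rcases hperm π with rfl | rfl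
  · have h : hkPointIso (1, ε) w = hkSignIso ε w := by simp [hkPointIso]
    rw [h, hkAb_hkSignIso]
    rfl
  · have hne : (Equiv.swap (0 : Fin 2) 1) ≠ 1 := by decide
    have h : hkPointIso (Equiv.swap 0 1, ε) w = hkSignIso ε (hkSwap w) := by simp [hkPointIso, hne]
    rw [h, hkAb_hkSignIso]
    fin_cases i <;> simp [hkAb, hkSwap]

/-! ## §4 The planar skeleton over the pair `j` -/

/-- **THE PLANAR SKELETON OF `H_{2k+1}(ℤ)` OVER THE PAIR `(a_j, b_j)`** (input Φ1 of the lane's node `SamePDropOfSkeleton`): `φ = (a_j, b_j)`,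
one frame type `1`, frames = left translations, point group = the diagonal `D₄`. [cite: KozmaNitzan2024, §4 p. 15] [cite: BenjaminiSchramm1996, Conj. 4] -/
def hkSkeleton (j : Fin k) : PlanarSkeleton (hkGraph k) where
  φ := hkAb j
  lip := fun _ _ h i => abs_hkAb_sub_le_one j h i
  types := {0}
  frame := fun v => ⟨0, Finset.mem_singleton_self _, hkLeftIso v, by simp, fun w => by simp [hkAb_hkMul, add_comm]⟩
  point := fun t ht g => by
    rw [Finset.mem_singleton] at ht
    subst ht
    exact ⟨hkPointIso g, hkPointIso_zero g, fun w => by simp [hkAb_hkPointIso]⟩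

/-- The skeleton map is `(a_j, b_j)`. [folklore] -/
@[simp] theorem hkSkeleton_φ (j : Fin k) : (hkSkeleton j).φ = hkAb j := rfl
/-- The base vertex set is `{1}`. [folklore] -/
@[simp] theorem hkSkeleton_types (j : Fin k) : (hkSkeleton j).types = {0} := rfl

/-- **The cylinders at `1`: `{|a_j| ≤ ℓ, |b_j| ≤ ℓ}`** (all other coordinates free — thick fibres). [folklore] -/
theorem mem_hkSkeleton_cyl (j : Fin k) (ℓ : ℕ) (w : HK k) : w ∈ (hkSkeleton j).cyl 0 ℓ ↔ |w.1 j| ≤ ℓ ∧ |w.2.1 j| ≤ ℓ := by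
  rw [PlanarSkeleton.mem_cyl, hkSkeleton_φ, hkAb_zero, sub_zero, mem_box]
  simp only [Fin.forall_fin_two, hkAb_apply_zero, hkAb_apply_one, abs_le]

end Summit.CriticalPhenomena.PercolationContinuityZ3.Theorems.Transplant

end
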